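import Literature.AlgebraicGeometry.ComplexMultiplication.AndreRiemannBiproducts
import Literature.AlgebraicGeometry.ComplexMultiplication.AndreRiemannRationalAction
import Literature.AlgebraicGeometry.ComplexMultiplication.CMTypedOfPrincipalCMPair
import Literature.AlgebraicGeometry.Milne1999.TateFromCodesHCOfRiemann
import Literature.NumberTheory.NumberFields.CMFieldCompositum
import Mathlib.NumberTheory.Cyclotomic.Basic
import Mathlib.NumberTheory.NumberField.CMField
import Mathlib.RingTheory.Polynomial.Cyclotomic.Roots
import HarnessLib

/-!
# André–Riemann decomposition: every complex CM abelian variety is dominated by a biproduct of CM-typed realisations of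
# ONE Galois CM field

Part 1 (inflation): a principal CM pair `(K, Φ)` realised on `A` inflates along a field extension `K ⊆ F` of CM fields to a
realisation of the induced type on a power of `A` (Shimura 1998 §5.2, §6.2 Thm. 3, §7.1 Prop. 7; `exists_inflation`,
`finrank_eq_two_mul_dim_of_isCMTypeRealisation`).
Part 2 (decomposition): granted Riemann's theorem in the form `DeligneMilne1982_Thm_6_20_full` (a Literature record, fed by
its `_holds` where used), a complex abelian variety of CM type `A` is dominated (`Domination.AVDominatedBy`) by a finite
biproduct `⨁_i A_i` of realisations of CM types `Φ_i` of ONE Galois CM field `F ⊇ ℚ(ζ₅)` with `[F:ℚ] > 2`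
(`exists_avDominatedBy_biproduct_realisations_of_riemann'`; Milne 2020 §3, proof of Thm. 1: «We may suppose that A is a
product of simple abelian varieties … Let F be a CM subfield of ℂ, Galois over ℚ, splitting the centre of End⁰(A)»).

Provenance: Literature home (namespace `Literature.AlgebraicGeometry.ComplexMultiplication.AndreRiemann`) of the Summits-side
`CorCM/AndreRiemannInflation` and `CorCM/AndreRiemannDecomposition` (imports `Literature/` and Mathlib only), re-homed so that
the Literature records of André 1992 (split and weak forms) and Milne 2020 Thm. 1 are discharged Literature-side. Lane
`lit-hodgefound`, seat p20.

## References
* [Milne2020HodgeClassesAV] J. S. Milne, *Hodge classes on abelian varieties* (2020), §3 Theorem 1 (proof).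
* [Shimura1998] G. Shimura, *Abelian Varieties with Complex Multiplication and Modular Functions* (1998), §5.2, §6.2 Thm. 3, §7.1.
* [DeligneMilne1982Tannakian] P. Deligne, J. S. Milne, *Tannakian categories*, LNM 900 (1982), Thm. 6.20.
-/

noncomputable section

namespace Literature.AlgebraicGeometry.ComplexMultiplication.AndreRiemann

/-! ## Part 1: inflation along a CM field extension -/

section Part1

open _root_.CategoryTheory _root_.CategoryTheory.Limits NumberField

open Literature.AlgebraicGeometry.Motives Literature.AlgebraicGeometry.Motives.AbelianVariety
open Literature.AlgebraicGeometry.HodgeTheory Literature.AlgebraicGeometry.ComplexMultiplication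
open Literature.AlgebraicGeometry.ComplexMultiplication.Domination

/-- The degree of the CM field of a realisation is twice the dimension: `[K₀ : ℚ] = 2 dim B`
(`dim_ℂ H¹(B(ℂ); ℂ) = [K₀:ℚ]` is a clause of `IsCMTypeRealisation`, and `b₁ = 2 dim`).
[cite: Shimura1998, §5.2 (pp. 36–37)] -/
theorem finrank_eq_two_mul_dim_of_isCMTypeRealisation {K₀ : Type} [Field K₀] [NumberField K₀]
    {Φ₀ : CMType K₀} {B : AbelianVariety ℂ} {ι₀ : 𝓞 K₀ →+* End B}
    {θ₀ : K₀ →+* Module.End ℂ (complexBetti B.X 1)} (h : IsCMTypeRealisation Φ₀ B ι₀ θ₀) :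
    Module.finrank ℚ K₀ = 2 * B.dim := by
  have h1 := h.2.1
  rw [← BettiUniverse.finrank_bettiCohomology_eq (AbelianVariety.isSmoothProjective_holds (A := B)) 1,
    finrank_bettiCohomology_one] at h1
  exact h1.symm

/-- **Inflation** (Shimura §6.2, `B ⊗_{K₀} L`): a realisation of a CM type of `K₀` and a number
field `L ⊇ K₀` give a realisation `(B′, ι′, θ′)` of some CM type `Ψ` of `L` with `B` a direct
factor of `B′` up to isogeny (`B′ ∼ B^{[L:K₀]}` with `L` acting through `L ↪ Mat(K₀)`, made principal
by Shimura §7.1 Prop. 7; the type is read on `H¹` by §5.2).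
[cite: Shimura1998, §6.2 Theorem 3 (proof, pp. 41–43), §7.1 Proposition 7 (p. 47), §5.2 (pp. 36–37)]
[cite: Deligne1982HodgeCycles, §5] -/
theorem exists_inflation {K₀ : Type} [Field K₀] [NumberField K₀] {Φ₀ : CMType K₀}
    {B : AbelianVariety ℂ} {ι₀ : 𝓞 K₀ →+* End B} {θ₀ : K₀ →+* Module.End ℂ (complexBetti B.X 1)}
    (h : IsCMTypeRealisation Φ₀ B ι₀ θ₀) {L : Type} [Field L] [NumberField L] (kL : K₀ →+* L) :
    ∃ (B' : AbelianVariety ℂ) (Ψ : CMType L) (ι' : 𝓞 L →+* End B')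
      (θ' : L →+* Module.End ℂ (complexBetti B'.X 1)),
      IsCMTypeRealisation Ψ B' ι' θ' ∧ AVDominatedBy B B' := by
  classical
  letI : Algebra K₀ L := kL.toAlgebra
  haveI : IsScalarTower ℚ K₀ L := IsScalarTower.of_algebraMap_eq fun q => by
    rw [RingHom.algebraMap_toAlgebra, eq_ratCast, eq_ratCast, map_ratCast]
  haveI : Module.Finite K₀ L := Module.Finite.of_restrictScalars_finite ℚ K₀ L
  -- `[K₀:ℚ] = 2 dim B`, `m = [L:K₀] ≥ 1`, `[L:ℚ] = m [K₀:ℚ]`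
  have hK₀ := finrank_eq_two_mul_dim_of_isCMTypeRealisation h
  set m := Module.finrank K₀ L with hm
  have hm0 : 0 < m := Module.finrank_pos
  have hLdeg : Module.finrank ℚ L = m * Module.finrank ℚ K₀ := by
    rw [← Module.finrank_mul_finrank ℚ K₀ L, mul_comm]
  -- `L ↪ Mat_m(K₀) ↪ End⁰(Bᵐ)`
  let γ := Module.finBasis K₀ L
  let φL : L →+* (⨁ fun _ : Fin m => B).endAlgebra :=
    (blockAct (ratAction ι₀)).comp (Algebra.leftMulMatrix γ).toRingHom
  -- the principal pair in the isogeny class of `Bᵐ` (Shimura §7.1 Prop. 7)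
  obtain ⟨B', φ', ι', hφι, u, hu⟩ := exists_principal_pair φL
  have hL : Module.finrank ℚ L = 2 * B'.dim := by
    rw [← dim_eq_of_isIsogeny hu, dim_biproduct_const, hLdeg, hK₀]
    ring
  -- the CM type read on `H¹` (Shimura §5.2)
  obtain ⟨Ψ, hΨ⟩ := isCMTypeRealisation_of_principal φ' hL ι' hφι
  exact ⟨B', Ψ, ι', complexAction φ', hΨ, avDominatedBy_of_isIsogenous_pow hm0 ⟨u, hu⟩⟩

end Part1

/-! ## Part 2: domination by a biproduct of realisations of one Galois CM field -/

section Part2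

open _root_.CategoryTheory _root_.CategoryTheory.Limits NumberField

open Literature.AlgebraicGeometry.Motives Literature.AlgebraicGeometry.Motives.AbelianVariety
open Literature.AlgebraicGeometry.HodgeTheory Literature.AlgebraicGeometry.ComplexMultiplication
open Literature.AlgebraicGeometry.Milne1999 Literature.NumberTheory.NumberFields
open Literature.AlgebraicGeometry.ComplexMultiplication.Domination

/-! ## §1 Products of CM-typed abelian varieties are dominated by products of `L`-typed ones -/

/-- **The inductive step over `IsProductOf IsCMTyped`.** A finite product `B` of CM-typed abelian
varieties comes with a finite set `T` of subfields of `ℂ` (images of the CM fields of the pieces),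
each finite over `ℚ` and embeddable in a CM field, such that for EVERY number field `L` receiving all
of them, `B` is a direct factor up to isogeny of a finite biproduct of realisations of CM types of
`L` (inflate each piece, Shimura §6.2, and glue). [cite: Milne2020HodgeClassesAV, Theorem 1 (proof)]
[cite: Shimura1998, §6.2 Theorem 3] -/
theorem exists_fields_dominating_family_of_isProductOf {B : AbelianVariety ℂ}
    (hB : IsProductOf IsCMTyped B) :
    ∃ T : Finset (IntermediateField ℚ ℂ),
      (∀ F ∈ T, FiniteDimensional ℚ F ∧
        ∃ (E : Type) (_ : Field E) (_ : NumberField E) (_ : IsCMField E), Nonempty (F →+* E)) ∧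
      ∀ (L : Type) [Field L] [NumberField L],
        (∀ F : T, ((F : IntermediateField ℚ ℂ) →+* L)) →
        ∃ (J : Type) (_ : Fintype J) (C : J → AbelianVariety ℂ) (Ψ : J → CMType L)
          (ι : ∀ j, 𝓞 L →+* End (C j)) (θ : ∀ j, L →+* Module.End ℂ (complexBetti (C j).X 1)),
          (∀ j, IsCMTypeRealisation (Ψ j) (C j) (ι j) (θ j)) ∧ AVDominatedBy B (⨁ C) := by
  classical
  induction hB with
  | @atom B hBt =>
    obtain ⟨Φ, _, ι, θ, h⟩ := hBt
    rename_i K _ _ _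
    obtain ⟨σ⟩ : Nonempty (K →+* ℂ) := inferInstance
    let σ' : K →ₐ[ℚ] ℂ := σ.toRatAlgHom
    refine ⟨{σ'.fieldRange}, fun F hF => ?_, fun L _ _ emb => ?_⟩
    · rw [Finset.mem_singleton] at hF
      subst hF
      exact ⟨σ'.toLinearMap.finiteDimensional_range, K, inferInstance, inferInstance, inferInstance,
        ⟨σ'.equivFieldRange.symm.toAlgHom.toRingHom⟩⟩
    · let kL : K →+* L := (emb ⟨σ'.fieldRange, Finset.mem_singleton_self _⟩).comp
        σ'.equivFieldRange.toAlgHom.toRingHom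
      obtain ⟨B', Ψ, ι', θ', hB', hdom⟩ := exists_inflation h kL
      exact ⟨Fin 1, inferInstance, fun _ => B', fun _ => Ψ, fun _ => ι', fun _ => θ', fun _ => hB',
        hdom.trans (avDominatedBy_biproduct_single B')⟩
  | @prod B₁ B₂ _ _ ih₁ ih₂ =>
    obtain ⟨T₁, hT₁, h₁⟩ := ih₁
    obtain ⟨T₂, hT₂, h₂⟩ := ih₂
    refine ⟨T₁ ∪ T₂, fun F hF => ?_, fun L _ _ emb => ?_⟩
    · rcases Finset.mem_union.mp hF with hF | hF
      · exact hT₁ F hF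
      · exact hT₂ F hF
    · obtain ⟨J₁, _, C₁, Ψ₁, ι₁, θ₁, hC₁, hd₁⟩ :=
        h₁ L fun F => emb ⟨F.1, Finset.mem_union_left _ F.2⟩
      obtain ⟨J₂, _, C₂, Ψ₂, ι₂, θ₂, hC₂, hd₂⟩ :=
        h₂ L fun F => emb ⟨F.1, Finset.mem_union_right _ F.2⟩
      refine ⟨J₁ ⊕ J₂, inferInstance, sumFam C₁ C₂,
        fun j => match j with | Sum.inl j => Ψ₁ j | Sum.inr j => Ψ₂ j,
        fun j => match j with | Sum.inl j => ι₁ j | Sum.inr j => ι₂ j,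
        fun j => match j with | Sum.inl j => θ₁ j | Sum.inr j => θ₂ j,
        fun j => match j with | Sum.inl j => hC₁ j | Sum.inr j => hC₂ j,
        avDominatedBy_prod_of_biproduct hd₁ hd₂⟩

/-! ## §2 The auxiliary field `ℚ(ζ₅)` and the common Galois CM field -/

/-- `ℚ(ζ₅)` is a CM field (Mathlib: nontrivial cyclotomic extensions of `ℚ` are CM). [cite: Milne2020HodgeClassesAV, Theorem 1 (proof), auxiliary step] -/
theorem isCMField_cyclotomicField_five : IsCMField (CyclotomicField 5 ℚ) :=
  @IsCyclotomicExtension.Rat.isCMField (CyclotomicField 5 ℚ) _ _ {5} ⟨5, rfl, by norm_num⟩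
    (CyclotomicField.isCyclotomicExtension 5 ℚ)

/-- `ℚ(ζ₅)` is Galois over `ℚ`. [cite: Milne2020HodgeClassesAV, Theorem 1 (proof), auxiliary step] -/
theorem isGalois_cyclotomicField_five : IsGalois ℚ (CyclotomicField 5 ℚ) :=
  @IsCyclotomicExtension.isGalois {5} ℚ (CyclotomicField 5 ℚ) _ _ _
    (CyclotomicField.isCyclotomicExtension 5 ℚ)

/-- `[ℚ(ζ₅) : ℚ] = 4`. [cite: Milne2020HodgeClassesAV, Theorem 1 (proof), auxiliary step] -/
theorem finrank_cyclotomicField_five : Module.finrank ℚ (CyclotomicField 5 ℚ) = 4 := by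
  have h := @IsCyclotomicExtension.finrank 5 _ ℚ (CyclotomicField 5 ℚ) _ _ _ _
    (CyclotomicField.isCyclotomicExtension 5 ℚ) (Polynomial.cyclotomic.irreducible_rat (n := 5) (by norm_num))
  rw [h]; decide

/-! ## §3 The reduction -/

/-- **Every complex abelian variety of CM type is a direct factor, up to isogeny, of a finite product
of CM-typed abelian varieties over ONE Galois CM field `L` with `[L:ℚ] > 2` — from Riemann's theorem**
(Deligne–Milne Thm. 6.20, displayed hypothesis `hR`). Deligne 1982 §5 / Milne 2020 proof of Thm. 1
(decompose up to isogeny into simple CM pieces, pass to a Galois CM field containing all their CM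
fields, inflate each piece); for `dim A = 0` the empty product serves.
[cite: Deligne1982HodgeCycles, §5] [cite: Milne2020HodgeClassesAV, Theorem 1 (proof)]
[cite: Shimura1998, §5.1 Props. 5–6, §6.2 Thm. 3, §18.2 Lemma] [cite: DeligneMilne1982Tannakian, Thm. 6.20] -/
theorem exists_dominating_cmTypedFamily_of_riemann (hR : DeligneMilne1982_Thm_6_20_full)
    (A : AbelianVariety ℂ) (hA : IsOfCMType A) :
    ∃ (L : Type) (_ : Field L) (_ : NumberField L) (_ : IsCMField L) (_ : IsGalois ℚ L),
      2 < Module.finrank ℚ L ∧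
      ∃ (n : ℕ) (C : Fin n → AbelianVariety ℂ) (Ψ : Fin n → CMType L)
        (ι : ∀ i, 𝓞 L →+* End (C i)) (θ : ∀ i, L →+* Module.End ℂ (complexBetti (C i).X 1)),
        (∀ i, IsCMTypeRealisation (Ψ i) (C i) (ι i) (θ i)) ∧ AVDominatedBy A (⨁ C) := by
  classical
  haveI hcm5 : IsCMField (CyclotomicField 5 ℚ) := isCMField_cyclotomicField_five
  rcases Nat.eq_zero_or_pos A.dim with hA0 | hApos
  · -- dimension `0`: the empty product over `ℚ(ζ₅)`
    refine ⟨CyclotomicField 5 ℚ, inferInstance, inferInstance, hcm5, isGalois_cyclotomicField_five, ?_, 0,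
      fun i => i.elim0, fun i => i.elim0, fun i => i.elim0, fun i => i.elim0, fun i => i.elim0,
      avDominatedBy_of_dim_eq_zero hA0 _⟩
    rw [finrank_cyclotomicField_five]; norm_num
  -- positive dimension: decomposition into CM-typed pieces (Poincaré; simple factors by `hR`)
  obtain ⟨B, hB, hAB⟩ := hDecompPos_of_hSimplePos (hSimplePos_of_riemann hR) A hApos hA
  obtain ⟨T, hT, hclaim⟩ := exists_fields_dominating_family_of_isProductOf hB
  -- the common field: Galois closure of the compositum of the pieces' fields and `ℚ(ζ₅)`
  let FF : Option T → Type := fun o => match o with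
    | none => CyclotomicField 5 ℚ
    | some F => ((F : IntermediateField ℚ ℂ) : Type)
  letI : ∀ o, Field (FF o) := fun o => match o with
    | none => inferInstance
    | some F => inferInstance
  haveI hnf : ∀ o, NumberField (FF o) := fun o => match o with
    | none => inferInstance
    | some F => by
      haveI : FiniteDimensional ℚ (F : IntermediateField ℚ ℂ) := (hT F.1 F.2).1
      exact { to_charZero := inferInstance, to_finiteDimensional := inferInstance }
  have hTR : ∀ o, IsTotallyReal (FF o) ∨ IsCMField (FF o) := fun o => match o with
    | none => Or.inr hcm5
    | some F => by
      haveI : NumberField ((F : IntermediateField ℚ ℂ) : Type) := hnf (some F)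
      obtain ⟨-, E, _, _, hE, ⟨f⟩⟩ := hT F.1 F.2
      exact isTotallyReal_or_isCMField_of_ringHom f (Or.inr hE)
  let L₀ : IntermediateField ℚ ℂ := ⨆ o, IntermediateField.normalClosure ℚ (FF o) ℂ
  haveI : FiniteDimensional ℚ L₀ := IntermediateField.finiteDimensional_iSup_of_finite
  haveI : NumberField L₀ := { to_charZero := inferInstance, to_finiteDimensional := inferInstance }
  have hCM : IsCMField L₀ := isCMField_iSup_normalClosure hTR (i₀ := none) hcm5
  have hGal : IsGalois ℚ L₀ := isGalois_iSup_normalClosure_complex FF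
  -- `[L₀ : ℚ] ≥ [ℚ(ζ₅) : ℚ] = 4`
  have hdeg : 2 < Module.finrank ℚ L₀ := by
    obtain ⟨σ₅⟩ : Nonempty (CyclotomicField 5 ℚ →+* ℂ) := inferInstance
    have hle : σ₅.toRatAlgHom.fieldRange ≤ L₀ :=
      (AlgHom.fieldRange_le_normalClosure σ₅.toRatAlgHom).trans
        (le_iSup (fun o => IntermediateField.normalClosure ℚ (FF o) ℂ) none)
    have h4 : Module.finrank ℚ σ₅.toRatAlgHom.fieldRange = 4 := by
      rw [← σ₅.toRatAlgHom.equivFieldRange.toLinearEquiv.finrank_eq, finrank_cyclotomicField_five]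
    have hmono := IntermediateField.finrank_le_of_le_right hle
    omega
  -- embeddings of the pieces' fields and the dominating family
  have emb : ∀ F : T, ((F : IntermediateField ℚ ℂ) →+* L₀) := fun F =>
    (IntermediateField.inclusion (E := (F : IntermediateField ℚ ℂ)) (F := L₀)
      ((show (F : IntermediateField ℚ ℂ) ≤ IntermediateField.normalClosure ℚ (FF (some F)) ℂ from
        (IntermediateField.fieldRange_val (F : IntermediateField ℚ ℂ)).symm.trans_le
          (AlgHom.fieldRange_le_normalClosure _)).trans
        (le_iSup (fun o => IntermediateField.normalClosure ℚ (FF o) ℂ) (some F)))).toRingHom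
  obtain ⟨J, _, C, Ψ, ι, θ, hC, hdom⟩ := hclaim L₀ emb
  let e : Fin (Fintype.card J) ≃ J := (Fintype.equivFin J).symm
  exact ⟨L₀, inferInstance, inferInstance, hCM, hGal, hdeg, Fintype.card J, C ∘ e, Ψ ∘ e,
    fun i => ι (e i), fun i => θ (e i), fun i => hC (e i),
    avDominatedBy_biproduct_reindex e (hdom.of_isIsogenous hAB)⟩

/-- The same statement in the conjunct shape of `Domination.exists_avDominatedBy_biproduct_realisations_of_riemann`
(b18, `Model/CMProdBiproduct.lean`) — WITHOUT the records `hU`, `h₃`: Riemann's theorem is the only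
hypothesis. [cite: Deligne1982HodgeCycles, §5] [cite: Milne2020HodgeClassesAV, Theorem 1 (proof)]
[cite: DeligneMilne1982Tannakian, Thm. 6.20] -/
theorem exists_avDominatedBy_biproduct_realisations_of_riemann' (hR : DeligneMilne1982_Thm_6_20_full)
    (A : AbelianVariety ℂ) (hA : IsOfCMType A) :
    ∃ (F : Type) (_ : Field F) (_ : NumberField F) (_ : IsCMField F),
      IsGalois ℚ F ∧ 2 < Module.finrank ℚ F ∧
        ∃ (n : ℕ) (B : Fin n → AbelianVariety ℂ) (Φ : Fin n → CMType F)
          (ι : ∀ i, 𝓞 F →+* End (B i)) (θ : ∀ i, F →+* Module.End ℂ (complexBetti (B i).X 1)),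
          (∀ i, IsCMTypeRealisation (Φ i) (B i) (ι i) (θ i)) ∧ AVDominatedBy A (⨁ B) := by
  obtain ⟨L, _, _, hCM, hGal, hdeg, n, C, Ψ, ι, θ, hC, hdom⟩ :=
    exists_dominating_cmTypedFamily_of_riemann hR A hA
  exact ⟨L, inferInstance, inferInstance, hCM, hGal, hdeg, n, C, Ψ, ι, θ, hC, hdom⟩

end Part2

end Literature.AlgebraicGeometry.ComplexMultiplication.AndreRiemann

end
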